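import Summits.ValiantsHypothesis.ValiantsHypothesis.Theorems.BarrierLeverChowThinRowsLabelledPairsHub

/-!
# Route BarrierLever — item `ChowHitsThinRowPartitionMinors` (stmt-ValiantsHypothesis-20195):
# the `s = 2` CAPACITY LAYOUT `Thin(5) × 2^4` is Chow-hit at every height

Helper file (`--supports stmt-ValiantsHypothesis-20195`; cell valiant-natproofs, rung V4, 𝒟-side of
door (c); prover seat val-np-p8 gen 0).  Closes NO item; imports only `…ChowThinRowsLabelledPairsHub`
(this seat; no route file).  Conventions as there.

**Theorem `chowHits_thinSubsetsOfFive_cubeOfFour`.**  For every `h ≥ 8`, every `5`-set `{z} ∪ B` of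
`x`-coordinates and `4`-set `c(B)` of `y`-coordinates (`c` injective on `B`), and ANY injective
enumerations: the `16 × 16` partition minor «all subsets of size `≤ 2` of the `5`-set × all subsets
of the `4`-set» is made nonsingular by ONE explicit product of `h + h` affine forms.  This is the
`s = 2` capacity-critical layout of memo THINROWS-MEMO-g10 §8 (`1 + 5 + C(5,2) = 2^4`: the
per-coordinate capacity `Σ_{l ≤ 2} C(m, l)` of a product of `m = 16` forms is exactly attained), the
pair-layer analogue of the TNS-refuting layouts; it has NO union labelling (file I does not reach it).
Design (`exists_design_capacityLayout`): indicator forms `1 + y_V` of the `16` column sets; `x_b`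
(`b ∈ B`) exactly in the singleton form of `c b` (labels `{c b}`); the hub `x_z` with coefficients
solved to `Σ_V κ₅(V) t_V = Σ_{|U| ≥ 2} y^U`.  Matching rows to columns by `u ↦ c(u)` (`z ∉ u`),
`{z} ↦ c(B)`, `{b, z} ↦ c(B) ∖ {c b}` and sorting columns by cardinality, the design is TRIANGULAR
(`det_ne_zero_of_triangularDesign`): the `11` hub-free rows are `t`-products (file I), the row `{z}`
is `B⁰ · 𝟙_{|U|≥2}` (nonzero exactly on the columns of size `≥ 2`, top column `c(B)`), and the row
`{b, z}` is `B⁰ · t_{{c b}} · (𝟙_{|U|≥2} - κ₅ t_{{c b}})`, whose coefficient at a column `W` of size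
`≥ 3` is `[c b ∉ W]` (`coeff_tinv_singleton_mul`).  Numerically (lab, exact): `det = -1`.
WHAT THIS IS NOT: one layout family (the capacity-critical one), not Conjecture DC; nothing on items
20195 / 20172 / 19717 themselves, on crux stmt-ValiantsHypothesis-14610, or on `VP` versus `VNP`.
-/

set_option linter.dupNamespace false

namespace Summit.ValiantsHypothesis.ValiantsHypothesis.Theorems.BarrierLever.ChowSubcube

open Finset MvPolynomial
open Summit.ValiantsHypothesis.ValiantsHypothesis.Theorems.BarrierLever.ChowFactor
  (coeff_partitionExpo_mul_affine coeff_partitionExpo_mul_yOnly totalDegree_affine_le)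
open Summit.ValiantsHypothesis.ValiantsHypothesis.Theorems.BarrierLever.ProductStateSums
  (castAdd_ne_natAdd partitionExpo_apply_castAdd partitionExpo_apply_natAdd)
open Summit.ValiantsHypothesis.ValiantsHypothesis.Theorems.BarrierLever.CorankRepair (partitionExpo_eq_iff)

variable {h : ℕ}

/-! ## 4. The `s = 2` capacity layout: all thin subsets of a 5-set × the cube of a 4-set -/

/-- **Core of the capacity layout (columns sorted by cardinality, rows matched).**  Variables: a hub
`z` and four `x`-diagonal variables `b ∈ B` labelled by the singletons `{c b}` of `T = c(B)`
(`|B| = 4`, `c` injective on `B`); rows: thin subsets of `insert z B`, matched to the columns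
`W ⊆ T` by `u ↦ c(u)` (`z ∉ u`), `{z} ↦ T`, `{b, z} ↦ T ∖ {c b}`.  With the hub SOLVED to
`Σ_V κ₅(V) t_V = Σ_{|U| ≥ 2} y^U`, the design is triangular: the partition minor is nonzero. -/
theorem exists_design_capacityLayout (B : Finset (Fin h)) (hB : B.card = 4) (z : Fin h)
    (c : Fin h → Fin h) (hc : Set.InjOn c ↑B)
    (r : ℕ) (u w : Fin r → Finset (Fin h)) (hw : Function.Injective w)
    (huA : ∀ i, u i ⊆ insert z B) (hu2 : ∀ i, (u i).card ≤ 2)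
    (hwT : ∀ j, w j ⊆ B.image c) (hsurj : ∀ W, W ⊆ B.image c → ∃ j, w j = W)
    (hmono : Monotone fun j => (w j).card)
    (hmatch0 : ∀ j, z ∉ u j → w j = (u j).image c)
    (hmatch1 : ∀ j, z ∈ u j → w j = B.image c \ ((u j).erase z).image c) :
    ∃ κ : Fin h → Finset (Fin h) → ℂ, (Matrix.of fun i j : Fin r => MvPolynomial.coeff
        (∑ a ∈ u i, Finsupp.single (Fin.castAdd h a) 1 +
          ∑ c' ∈ w j, Finsupp.single (Fin.natAdd h c') 1)
        (∏ V ∈ (B.image c).powerset, (C 1 + ∑ a, C (κ a V) * X (Fin.castAdd h a) +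
          ∑ c', C (if c' ∈ V then (1 : ℂ) else 0) * X (Fin.natAdd h c')))).det ≠ 0 := by
  classical
  set T : Finset (Fin h) := B.image c with hTdef
  set DD : Finset (Finset (Fin h)) := T.powerset with hDDdef
  have hDD : ∀ W ∈ DD, ∀ U : Finset (Fin h), U ⊆ W → U ∈ DD := fun W hW U hU =>
    Finset.mem_powerset.mpr (hU.trans (Finset.mem_powerset.mp hW))
  have hwD : ∀ j, w j ∈ DD := fun j => Finset.mem_powerset.mpr (hwT j)
  have hsurjD : ∀ V ∈ DD, ∃ j, w j = V := fun V hV => hsurj V (Finset.mem_powerset.mp hV)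
  have hTcard : T.card = 4 := by rw [hTdef, Finset.card_image_of_injOn hc, hB]
  have hTD : T ∈ DD := Finset.mem_powerset.mpr (subset_refl _)
  -- the hub, solved to the indicator of `|U| ≥ 2`
  obtain ⟨κ₅, hκ₅⟩ := exists_tcoords_eq DD r w hw hwD hsurjD hmono
    (fun l => if 2 ≤ (w l).card then (1 : ℂ) else 0)
  set G : MvPolynomial (Fin (h + h)) ℂ := ∑ U' ∈ DD.filter (fun U' => 2 ≤ U'.card),
    monomial (∑ a ∈ (∅ : Finset (Fin h)), Finsupp.single (Fin.castAdd h a) 1 +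
      ∑ c' ∈ U', Finsupp.single (Fin.natAdd h c') 1) (1 : ℂ) with hGdef
  have hG : ∀ s ∈ G.support, ∀ a : Fin h, s (Fin.castAdd h a) = 0 :=
    yOnly_sum _ _ fun U' _ => yOnly_monomial _ _ fun a => by
      rw [partitionExpo_apply_castAdd]; simp
  have hGcoeff : ∀ U : Finset (Fin h), coeff (∑ a ∈ (∅ : Finset (Fin h)), Finsupp.single (Fin.castAdd h a) 1 +
      ∑ c' ∈ U, Finsupp.single (Fin.natAdd h c') 1) G = if U ∈ DD ∧ 2 ≤ U.card then 1 else 0 :=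
    fun U => coeff_indicatorPoly DD _ U
  have hsolve : ∀ U ∈ DD, ∑ V ∈ DD, κ₅ V * coeff (∑ a ∈ (∅ : Finset (Fin h)), Finsupp.single (Fin.castAdd h a) 1 +
        ∑ c' ∈ U, Finsupp.single (Fin.natAdd h c') 1)
        (∑ U' ∈ V.powerset, monomial (∑ a ∈ (∅ : Finset (Fin h)), Finsupp.single (Fin.castAdd h a) 1 +
          ∑ c' ∈ U', Finsupp.single (Fin.natAdd h c') 1) ((-1 : ℂ) ^ U'.card * (U'.card.factorial : ℂ))) =
      coeff (∑ a ∈ (∅ : Finset (Fin h)), Finsupp.single (Fin.castAdd h a) 1 +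
        ∑ c' ∈ U, Finsupp.single (Fin.natAdd h c') 1) G := by
    intro U hU
    obtain ⟨l, rfl⟩ := hsurjD U hU
    rw [hκ₅ l, hGcoeff]
    by_cases h2 : 2 ≤ (w l).card
    · rw [if_pos h2, if_pos ⟨hU, h2⟩]
    · rw [if_neg h2, if_neg (fun h' => h2 h'.2)]
  -- the design
  set κ : Fin h → Finset (Fin h) → ℂ := fun a V =>
    if a = z then κ₅ V else (if V = {c a} then 1 else 0) with hκdef
  have hκz : ∀ V ∈ DD, κ z V = κ₅ V := fun V _ => by simp [hκdef]
  have hκa : ∀ a, a ≠ z → ∀ V ∈ DD, κ a V = if V = {c a} then 1 else 0 := fun a ha V _ => by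
    simp [hκdef, ha]
  refine ⟨κ, ?_⟩
  -- truncated inverse of a set, as a polynomial
  set tp : Finset (Fin h) → MvPolynomial (Fin (h + h)) ℂ := fun S => ∑ U' ∈ S.powerset,
    monomial (∑ a ∈ (∅ : Finset (Fin h)), Finsupp.single (Fin.castAdd h a) 1 +
      ∑ c' ∈ U', Finsupp.single (Fin.natAdd h c') 1) ((-1 : ℂ) ^ U'.card * (U'.card.factorial : ℂ)) with htp
  -- useful facts about rows containing the hub
  have hmemB : ∀ j, ∀ a ∈ u j, a ≠ z → a ∈ B := fun j a ha haz => by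
    have := huA j ha
    rw [Finset.mem_insert] at this
    exact this.resolve_left haz
  have hlabD : ∀ a ∈ B, ({c a} : Finset (Fin h)) ∈ DD := fun a ha =>
    Finset.mem_powerset.mpr (Finset.singleton_subset_iff.mpr (Finset.mem_image_of_mem c ha))
  have hpair : ∀ j, z ∈ u j → (u j).card = 2 → ∃ a, a ≠ z ∧ a ∈ B ∧ u j = {a, z} := by
    intro j hzj h2
    obtain ⟨x, y, hxy, hxy'⟩ := Finset.card_eq_two.mp h2
    have hzxy : z = x ∨ z = y := by
      rw [hxy'] at hzj; simpa [Finset.mem_insert, Finset.mem_singleton] using hzj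
    rcases hzxy with e | e
    · refine ⟨y, fun e' => hxy (e'.trans e).symm, hmemB j y (by rw [hxy']; simp)
        (fun e' => hxy (e'.trans e).symm), ?_⟩
      rw [hxy', ← e, Finset.pair_comm]
    · refine ⟨x, fun e' => hxy (e'.trans e), hmemB j x (by rw [hxy']; simp)
        (fun e' => hxy (e'.trans e)), ?_⟩
      rw [hxy', ← e]
  have hsing : ∀ j, z ∈ u j → (u j).card ≤ 1 → u j = {z} := by
    intro j hzj h1
    have h1' : (u j).card = 1 := le_antisymm h1 (Finset.card_pos.mpr ⟨z, hzj⟩)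
    obtain ⟨x, hx⟩ := Finset.card_eq_one.mp h1'
    rw [hx] at hzj ⊢
    rw [Finset.mem_singleton.mp hzj]
  -- coefficients of `Q_a = G - κ₅({c a}) t_{{c a}}`
  have hQ : ∀ (a : Fin h) (U : Finset (Fin h)), coeff (∑ a' ∈ (∅ : Finset (Fin h)), Finsupp.single (Fin.castAdd h a') 1 +
      ∑ c' ∈ U, Finsupp.single (Fin.natAdd h c') 1) (G + C (-κ₅ {c a}) * tp {c a}) =
      (if U ∈ DD ∧ 2 ≤ U.card then (1 : ℂ) else 0) +
        -κ₅ {c a} * (if U ⊆ {c a} then (-1 : ℂ) ^ U.card * (U.card.factorial : ℂ) else 0) := by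
    intro a U
    rw [coeff_add, coeff_C_mul, hGcoeff, htp, coeff_tinv]
  have hQ1 : ∀ (a : Fin h) (U : Finset (Fin h)), U ∈ DD → 2 ≤ U.card →
      coeff (∑ a' ∈ (∅ : Finset (Fin h)), Finsupp.single (Fin.castAdd h a') 1 +
        ∑ c' ∈ U, Finsupp.single (Fin.natAdd h c') 1) (G + C (-κ₅ {c a}) * tp {c a}) = 1 := by
    intro a U hU h2
    rw [hQ a U, if_pos ⟨hU, h2⟩, if_neg]
    · ring
    · intro hsub
      have := Finset.card_le_card hsub
      rw [Finset.card_singleton] at this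
      omega
  have himg : ∀ S : Finset (Fin h), S.biUnion (fun a => ({c a} : Finset (Fin h))) = S.image c := by
    intro S; ext x
    simp only [Finset.mem_biUnion, Finset.mem_singleton, Finset.mem_image]
    exact ⟨fun ⟨a, ha, e⟩ => ⟨a, ha, e.symm⟩, fun ⟨a, ha, e⟩ => ⟨a, ha, e.symm⟩⟩
  -- labels of non-hub rows
  have hlab : ∀ j, z ∉ u j → ∀ a ∈ u j, ({c a} : Finset (Fin h)) ∈ DD := fun j hzj a ha =>
    hlabD a (hmemB j a ha fun e => hzj (e ▸ ha))
  have hlabinj : ∀ j, z ∉ u j → ∀ a ∈ u j, ∀ b ∈ u j, ({c a} : Finset (Fin h)) = {c b} → a = b :=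
    fun j hzj a ha b hb e => hc (hmemB j a ha fun e' => hzj (e' ▸ ha)) (hmemB j b hb fun e' => hzj (e' ▸ hb))
      (Finset.singleton_injective e)
  -- column of a hub pair row
  have hcolpair : ∀ j a, a ≠ z → u j = {a, z} → w j = T.erase (c a) := by
    intro j a haz hu
    rw [hmatch1 j (by rw [hu]; simp), hu, Finset.pair_comm, Finset.erase_insert (by simpa using haz.symm),
      Finset.image_singleton, Finset.sdiff_singleton_eq_erase]
  have hcolsing : ∀ j, u j = {z} → w j = T := by
    intro j hu
    rw [hmatch1 j (by rw [hu]; simp), hu, Finset.erase_singleton, Finset.image_empty, Finset.sdiff_empty]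
  -- the triangular design
  refine det_ne_zero_of_triangularDesign DD hDD r u w hw hwD hsurjD hmono _
    (∏ V' ∈ DD, (C 1 + ∑ a, C ((fun (_ : Fin h) (_ : Finset (Fin h)) => (0 : ℂ)) a V') * X (Fin.castAdd h a) +
      ∑ c', C (if c' ∈ V' then (1 : ℂ) else 0) * X (Fin.natAdd h c')))
    (coeff_empty_empty_prod _ _)
    (fun j => if z ∈ u j then (∏ a ∈ (u j).erase z, tp {c a}) *
        (G + ∑ a ∈ (u j).erase z, C (-κ₅ {c a}) * tp {c a}) else ∏ a ∈ u j, tp {c a})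
    (fun j => ?_) (fun j k => ?_) (fun j k hne => ?_) (fun j => ?_)
  · -- `y`-only
    by_cases hzj : z ∈ u j
    · rw [if_pos hzj]
      refine yOnly_mul (yOnly_prod _ _ fun a _ => yOnly_tinv {c a})
        (yOnly_add hG (yOnly_sum _ _ fun a _ => yOnly_mul ?_ (yOnly_tinv {c a})))
      rw [C_apply]
      exact yOnly_monomial 0 _ fun _ => rfl
    · rw [if_neg hzj]
      exact yOnly_prod _ _ fun a _ => yOnly_tinv {c a}
  · -- row formula
    by_cases hzj : z ∈ u j
    · rw [if_pos hzj]
      rcases Nat.lt_or_ge (u j).card 2 with h1 | h2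
      · have hu : u j = {z} := hsing j hzj (by omega)
        rw [hu, Finset.erase_singleton, Finset.prod_empty,
          Finset.sum_empty (f := fun a => C (-κ₅ {c a}) * tp {c a}), add_zero, one_mul]
        exact coeff_hub_row DD hDD κ z κ₅ hκz G hG hsolve (w k) (hwD k)
      · obtain ⟨a, haz, haB, hu⟩ := hpair j hzj (le_antisymm (hu2 j) h2)
        rw [hu, Finset.pair_comm, Finset.erase_insert (by simpa using haz.symm), Finset.prod_singleton,
          Finset.sum_singleton, ← Finset.pair_comm]
        exact coeff_hubPair_row DD hDD κ z κ₅ hκz G hG hsolve a haz {c a} (hlabD a haB)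
          (hκa a haz) (w k) (hwD k)
    · rw [if_neg hzj]
      exact coeff_xdiag_row DD κ (fun a => {c a}) (u j) (hu2 j) (hlab j hzj) (hlabinj j hzj)
        (fun a ha V hV => hκa a (fun e => hzj (e ▸ ha)) V hV) (w k)
  · -- support
    by_cases hzj : z ∈ u j
    · rw [if_pos hzj] at hne
      rcases Nat.lt_or_ge (u j).card 2 with h1 | h2
      · have hu : u j = {z} := hsing j hzj (by omega)
        rw [hu, Finset.erase_singleton, Finset.prod_empty,
          Finset.sum_empty (f := fun a => C (-κ₅ {c a}) * tp {c a}), add_zero, one_mul, hGcoeff] at hne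
        have hwj : w j = T := hcolsing j hu
        by_cases hk : w k = T
        · exact Or.inr (hw (hk.trans hwj.symm))
        · exact Or.inl (hwj ▸ Finset.card_lt_card (Finset.ssubset_iff_subset_ne.mpr ⟨hwT k, hk⟩))
      · obtain ⟨a, haz, haB, hu⟩ := hpair j hzj (le_antisymm (hu2 j) h2)
        have hwj : w j = T.erase (c a) := hcolpair j a haz hu
        have hcaT : c a ∈ T := Finset.mem_image_of_mem c haB
        have hwjcard : (w j).card = 3 := by rw [hwj, Finset.card_erase_of_mem hcaT, hTcard]
        rw [hu, Finset.pair_comm, Finset.erase_insert (by simpa using haz.symm), Finset.prod_singleton,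
          Finset.sum_singleton, coeff_tinv_singleton_mul] at hne
        by_cases h3 : (w k).card < 3
        · exact Or.inl (by rw [hwjcard]; exact h3)
        · right
          have hk3 : 3 ≤ (w k).card := by omega
          have hca : c a ∉ w k := by
            intro hca
            apply hne
            rw [if_pos hca, hQ1 a (w k) (hwD k) (by omega),
              hQ1 a ((w k).erase (c a)) (hDD (w k) (hwD k) _ (Finset.erase_subset _ _))
                (by rw [Finset.card_erase_of_mem hca]; omega)]
            ring
          have hsub : w k ⊆ T.erase (c a) := Finset.subset_erase.mpr ⟨hwT k, hca⟩
          have hle : (T.erase (c a)).card ≤ (w k).card := by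
            rw [Finset.card_erase_of_mem hcaT, hTcard]; omega
          exact hw ((Finset.eq_of_subset_of_card_le hsub hle).trans hwj.symm)
    · rw [if_neg hzj] at hne
      have hsub : w k ⊆ w j := by
        rw [hmatch0 j hzj, ← himg]
        exact coeff_tprod_subset (u j) (fun a => {c a}) (w k) hne
      rcases (Finset.card_le_card hsub).lt_or_eq with hlt | heq
      · exact Or.inl hlt
      · exact Or.inr (hw (Finset.eq_of_subset_of_card_le hsub heq.ge))
  · -- diagonal
    by_cases hzj : z ∈ u j
    · rw [if_pos hzj]
      rcases Nat.lt_or_ge (u j).card 2 with h1 | h2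
      · have hu : u j = {z} := hsing j hzj (by omega)
        rw [hu, Finset.erase_singleton, Finset.prod_empty,
          Finset.sum_empty (f := fun a => C (-κ₅ {c a}) * tp {c a}), add_zero, one_mul, hGcoeff,
          hcolsing j hu, if_pos ⟨hTD, by omega⟩]
        exact one_ne_zero
      · obtain ⟨a, haz, haB, hu⟩ := hpair j hzj (le_antisymm (hu2 j) h2)
        have hwj : w j = T.erase (c a) := hcolpair j a haz hu
        have hcaT : c a ∈ T := Finset.mem_image_of_mem c haB
        rw [hu, Finset.pair_comm, Finset.erase_insert (by simpa using haz.symm), Finset.prod_singleton,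
          Finset.sum_singleton, coeff_tinv_singleton_mul, hwj, if_neg (Finset.notMem_erase _ _),
          sub_zero, hQ1 a (T.erase (c a)) (hDD T hTD _ (Finset.erase_subset _ _))
            (by rw [Finset.card_erase_of_mem hcaT, hTcard]; norm_num)]
        exact one_ne_zero
    · rw [if_neg hzj]
      obtain ⟨n, hn, hn1⟩ := coeff_tprod_signed (u j) (fun a => {c a}) (w j)
      rw [hn]
      have h1 : 1 ≤ n := hn1 (by rw [himg, hmatch0 j hzj])
      exact mul_ne_zero (pow_ne_zero _ (by norm_num)) (by exact_mod_cast (by omega : n ≠ 0))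


/-- **THE `s = 2` CAPACITY LAYOUT IS CHOW-HIT AT EVERY HEIGHT `h ≥ 8`** (item
`ChowHitsThinRowPartitionMinors`, stmt-ValiantsHypothesis-20195, on the capacity-critical layout of
the pair layer).  Rows: ALL `16` subsets of size `≤ 2` of a `5`-set `{z} ∪ B` of `x`-coordinates;
columns: ALL `16` subsets of a `4`-set `c(B)` of `y`-coordinates (any injective enumerations).  ONE
explicit product of `h + h` affine forms — the indicator forms `1 + y_V` of the `16` column sets,
carrying `x_b` exactly in the singleton form of `c b` (`b ∈ B`) and the hub `x_z` with solved
coefficients — makes the `16 × 16` partition minor nonsingular.  This is the `s = 2` analogue of the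
TNS capacity test (`1 + 5 + 10 = 2^4`: per-coordinate capacity is exactly attained), which no
witness template of capacity `< 16` passes; with `chowHits_thinRows_of_unionLabelling` (the cases
`2^1`, `2^2`) every square layout «all thin subsets of an `m`-set × a full cube» is now Chow-hit in
the kernel. -/
theorem chowHits_thinSubsetsOfFive_cubeOfFour (h : ℕ) (hh : 8 ≤ h) (B : Finset (Fin h))
    (hB : B.card = 4) (z : Fin h) (hz : z ∉ B) (c : Fin h → Fin h) (hc : Set.InjOn c ↑B)
    (r : ℕ) (u w : Fin r → Finset (Fin h)) (hw : Function.Injective w)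
    (huA : ∀ i, u i ⊆ insert z B) (hu2 : ∀ i, (u i).card ≤ 2)
    (husurj : ∀ S, S ⊆ insert z B → S.card ≤ 2 → ∃ i, u i = S)
    (hwT : ∀ j, w j ⊆ B.image c) (hwsurj : ∀ W, W ⊆ B.image c → ∃ j, w j = W) :
    ∃ ℓ : Fin (h + h) → MvPolynomial (Fin (h + h)) ℂ, (∀ k, (ℓ k).totalDegree ≤ 1) ∧
      (Matrix.of fun i j : Fin r => MvPolynomial.coeff
        (∑ a ∈ u i, Finsupp.single (Fin.castAdd h a) 1 +
          ∑ c' ∈ w j, Finsupp.single (Fin.natAdd h c') 1) (∏ k, ℓ k)).det ≠ 0 := by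
  classical
  set T : Finset (Fin h) := B.image c with hTdef
  have hTcard : T.card = 4 := by rw [hTdef, Finset.card_image_of_injOn hc, hB]
  -- Step 1: match every column to a row
  have hmatchEx : ∀ W, W ⊆ T → ∃ S : Finset (Fin h), S ⊆ insert z B ∧ S.card ≤ 2 ∧
      (z ∉ S → W = S.image c) ∧ (z ∈ S → W = T \ (S.erase z).image c) := by
    intro W hWT
    have hWcard : W.card ≤ 4 := hTcard ▸ Finset.card_le_card hWT
    rcases Nat.lt_or_ge W.card 3 with h2 | h3
    · -- `|W| ≤ 2`: the preimage of `W` in `B`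
      refine ⟨B.filter (fun b => c b ∈ W), (Finset.filter_subset _ _).trans (Finset.subset_insert _ _),
        ?_, fun _ => ?_, fun hzS => absurd (Finset.mem_filter.mp hzS).1 hz⟩
      · have himg : (B.filter (fun b => c b ∈ W)).image c = W := by
          ext x
          simp only [Finset.mem_image, Finset.mem_filter]
          constructor
          · rintro ⟨b, ⟨-, hb⟩, rfl⟩; exact hb
          · intro hx
            obtain ⟨b, hb, rfl⟩ := Finset.mem_image.mp (hWT hx)
            exact ⟨b, ⟨hb, hx⟩, rfl⟩
        rw [← Finset.card_image_of_injOn (hc.mono (by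
          intro b hb; exact (Finset.mem_filter.mp hb).1)), himg]
        omega
      · ext x
        simp only [Finset.mem_image, Finset.mem_filter]
        constructor
        · intro hx
          obtain ⟨b, hb, rfl⟩ := Finset.mem_image.mp (hWT hx)
          exact ⟨b, ⟨hb, hx⟩, rfl⟩
        · rintro ⟨b, ⟨-, hb⟩, rfl⟩; exact hb
    rcases Nat.lt_or_ge W.card 4 with h3' | h4
    · -- `|W| = 3`: `T \ W = {c b}`, row `{b, z}`
      have hsd : (T \ W).card = 1 := by rw [Finset.card_sdiff_of_subset hWT, hTcard]; omega
      obtain ⟨d, hd⟩ := Finset.card_eq_one.mp hsd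
      have hdT : d ∈ T := (Finset.mem_sdiff.mp (hd ▸ Finset.mem_singleton_self d)).1
      obtain ⟨b, hb, hbd⟩ := Finset.mem_image.mp hdT
      have hbz : b ≠ z := fun e => hz (e ▸ hb)
      refine ⟨{b, z}, ?_, by rw [Finset.card_pair hbz], fun hzS => absurd (by simp) hzS, fun _ => ?_⟩
      · intro x hx
        rcases Finset.mem_insert.mp hx with rfl | hx'
        · exact Finset.mem_insert_of_mem hb
        · rw [Finset.mem_singleton.mp hx']; exact Finset.mem_insert_self _ _
      · rw [Finset.pair_comm, Finset.erase_insert (by simpa using hbz.symm), Finset.image_singleton, hbd,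
          ← hd, Finset.sdiff_sdiff_eq_self hWT]
    · -- `|W| = 4`: `W = T`, row `{z}`
      have hWT' : W = T := Finset.eq_of_subset_of_card_le hWT (by omega)
      refine ⟨{z}, Finset.singleton_subset_iff.mpr (Finset.mem_insert_self _ _), by simp,
        fun hzS => absurd (Finset.mem_singleton_self z) hzS, fun _ => ?_⟩
      rw [Finset.erase_singleton, Finset.image_empty, Finset.sdiff_empty, hWT']
  choose S hS using hmatchEx
  have hrow : ∀ j, ∃ i, u i = S (w j) (hwT j) := fun j =>
    husurj _ (hS (w j) (hwT j)).1 (hS (w j) (hwT j)).2.1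
  choose π hπ using hrow
  have hπinj : Function.Injective π := by
    intro j j' e
    apply hw
    have hSS : S (w j) (hwT j) = S (w j') (hwT j') := ((e ▸ hπ j).symm.trans (hπ j'))
    -- recover the column from its matched row
    by_cases hzS : z ∈ S (w j) (hwT j)
    · rw [(hS (w j) (hwT j)).2.2.2 hzS, (hS (w j') (hwT j')).2.2.2 (hSS ▸ hzS), hSS]
    · rw [(hS (w j) (hwT j)).2.2.1 hzS, (hS (w j') (hwT j')).2.2.1 (hSS ▸ hzS), hSS]
  set σ₀ : Equiv.Perm (Fin r) := Equiv.ofBijective π (Finite.injective_iff_bijective.mp hπinj) with hσ₀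
  -- Step 2: sort the columns by cardinality
  set σ : Equiv.Perm (Fin r) := Tuple.sort fun j => (w j).card with hσ
  have hmono : Monotone fun j => (w (σ j)).card := Tuple.monotone_sort fun j => (w j).card
  -- Step 3: the design on the matched, sorted layout
  obtain ⟨κ, hdet⟩ := exists_design_capacityLayout B hB z c hc r (u ∘ π ∘ σ) (w ∘ σ)
    (hw.comp σ.injective) (fun i => huA _) (fun i => hu2 _) (fun j => hwT _)
    (fun W hW => by obtain ⟨j, hj⟩ := hwsurj W hW; exact ⟨σ.symm j, by simp [hj]⟩) hmono
    (fun j hzj => by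
      have e := hπ (σ j)
      simp only [Function.comp_apply] at hzj ⊢
      rw [e] at hzj ⊢
      exact (hS _ _).2.2.1 hzj)
    (fun j hzj => by
      have e := hπ (σ j)
      simp only [Function.comp_apply] at hzj ⊢
      rw [e] at hzj ⊢
      exact (hS _ _).2.2.2 hzj)
  -- Step 4: the forms
  have hcard : (B.image c).powerset.card ≤ h + h := by
    rw [Finset.card_powerset, ← hTdef, hTcard]; omega
  obtain ⟨ℓ, hℓdeg, hℓprod⟩ := exists_forms_of_card_le (B.image c).powerset hcard
    (fun V => C 1 + ∑ a, C (κ a V) * X (Fin.castAdd h a) +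
      ∑ c', C (if c' ∈ V then (1 : ℂ) else 0) * X (Fin.natAdd h c'))
    (fun V _ => by
      have e : (C 1 + ∑ a, C (κ a V) * X (Fin.castAdd h a) +
          ∑ c', C (if c' ∈ V then (1 : ℂ) else 0) * X (Fin.natAdd h c') : MvPolynomial (Fin (h + h)) ℂ) =
          C 1 + ∑ v : Fin (h + h), C (Fin.append (fun a => κ a V)
            (fun c' => if c' ∈ V then (1 : ℂ) else 0) v) * X v := by
        rw [Fin.sum_univ_add]
        simp only [Fin.append_left, Fin.append_right, add_assoc]
      rw [e]
      exact totalDegree_affine_le _ _)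
  refine ⟨ℓ, hℓdeg, ?_⟩
  rw [hℓprod]
  -- Step 5: undo the re-indexing
  intro hzero
  apply hdet
  set M : Matrix (Fin r) (Fin r) ℂ := Matrix.of fun i j : Fin r => MvPolynomial.coeff
    (∑ a ∈ u i, Finsupp.single (Fin.castAdd h a) 1 + ∑ c' ∈ w j, Finsupp.single (Fin.natAdd h c') 1)
    (∏ V ∈ (B.image c).powerset, (C 1 + ∑ a, C (κ a V) * X (Fin.castAdd h a) +
      ∑ c', C (if c' ∈ V then (1 : ℂ) else 0) * X (Fin.natAdd h c'))) with hM
  have e1 : (Matrix.of fun i j : Fin r => MvPolynomial.coeff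
      (∑ a ∈ (u ∘ π ∘ σ) i, Finsupp.single (Fin.castAdd h a) 1 +
        ∑ c' ∈ (w ∘ σ) j, Finsupp.single (Fin.natAdd h c') 1)
      (∏ V ∈ (B.image c).powerset, (C 1 + ∑ a, C (κ a V) * X (Fin.castAdd h a) +
        ∑ c', C (if c' ∈ V then (1 : ℂ) else 0) * X (Fin.natAdd h c')))) =
      (M.submatrix σ₀ id).submatrix σ σ := by
    ext i j
    simp only [hM, Matrix.submatrix_apply, Matrix.of_apply, Function.comp_apply, id, hσ₀,
      Equiv.ofBijective_apply]
  rw [e1, Matrix.det_submatrix_equiv_self, Matrix.det_permute, hzero, mul_zero]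

end Summit.ValiantsHypothesis.ValiantsHypothesis.Theorems.BarrierLever.ChowSubcube
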